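import Literature.MathematicalPhysics.QuantumLattice.SectorSpectrum
import HarnessLib

/-!
# Sector-wise eigenvector bounds for a diagonal conserved charge pass to EVERY eigenvector and to
# the tracial ground state

Topic `MathematicalPhysics/QuantumLattice` (model-free linear algebra; family `hubbard`). Setting: a
Hermitian `A`, a REAL DIAGONAL charge `D_f = diagonal (f : ℂ)` commuting with `A` (on a fermionic Fock
space `S^z`, `N̂`: `LiebThm1.spinZ_eq_diagonal`, `totalNumber_eq_diagonal`), an observable `X` commuting
with `D_f`. Certificates read in symmetry SECTORS (Han 2020 §3) deliver bounds of the shape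
(S) `∀ M, ∀ unit φ with D_f φ = M φ and A φ = E φ : c ≤ Re ⟨φ, X φ⟩` (e.g. the `S^z`-eigenvector cells
`Summit.Ventures.CertifiedManyBodySolver.SourcedTorusCorrLowerRow[GS]` of the pinning-field menus).
* §1–§2: (S) ⇒ `c ≤ Re ⟨ψ, X ψ⟩` for EVERY unit eigenvector `A ψ = E ψ`
  (`le_re_star_dotProduct_mulVec_of_forall_fiber`): the fibre components `ψ|_{f = M}`
  (`Set.indicator {i | f i = M} ψ`) are eigenvectors of `A` at `E` in the `M`-eigenspace of the charge
  (`mulVec_indicator_fiber_of_commute`) and the quadratic form of `X` splits over the fibres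
  (`star_dotProduct_mulVec_eq_sum_fiber`).
* §3: `∀ unit ground-state vectors ψ : c ≤ Re ⟨ψ, X ψ⟩` ⇒ `c ≤ Re ω₀(X)` for the TRACIAL ground state
  `ω₀ = Matrix.groundStateFunctional A = tr(P₀ ·)/tr P₀` (`le_re_groundStateFunctional_of_forall_isGroundStateVector`;
  `tr(P₀ X) = Σ_σ ⟨P₀ e_σ, X P₀ e_σ⟩`, columns of `P₀` are ground vectors, `tr P₀ > 0`; Tasaki 2020 §2.1,
  App. A.2; Bratteli–Robinson II §5.3.1). §4: (S) for ground-state vectors ⇒ `c ≤ Re ω₀(X)`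
  (`le_re_groundStateFunctional_of_forall_fiber`); upper twins by `X ↦ −X`.
Use (cell `hubbard-cq`, LADDER row PC-a): `m_L(h) = Re ω₀(Δ_d)/L²` (`dWaveSourceDensity[TT']`) is TRACIAL,
the K5-menu cells are `S^z`-sectorial; §4 is the bridge (`Rows/SourcedTorusRowsDensityBridge.lean`).
Everything is PROVED; no definition, no named fact (the column average generalises the BEC line's
`stub_average` to the Literature layer).

References: H. Tasaki, *Physics and Mathematics of Quantum Many-Body Systems* (2020) §2.1, App. A.2
[cite: Tasaki2020, §2.1]; O. Bratteli, D. W. Robinson, *Operator Algebras and Quantum Statistical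
Mechanics II* §5.3.1 [cite: BratteliRobinsonII1997, §5.3.1]; X. Han, arXiv:2006.06002 §3
[cite: Han2020Bootstrap, §3].
-/

noncomputable section

namespace Literature.MathematicalPhysics.QuantumLattice

open Matrix Finset
open scoped ComplexOrder BigOperators

variable {n : Type*} [Fintype n] [DecidableEq n]

/-! ## §1 Fibres of a real diagonal charge -/

section Fiber
omit [Fintype n] [DecidableEq n] in
/-- Restriction to a set commutes with scalars: `(a • ψ)|_s = a • ψ|_s`. [folklore] -/
private theorem indicator_smul_vec (s : Set n) (a : ℂ) (ψ : n → ℂ) :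
    Set.indicator s (a • ψ) = a • Set.indicator s ψ := by
  ext i
  by_cases hi : i ∈ s
  · rw [Set.indicator_of_mem hi, Pi.smul_apply, Pi.smul_apply, Set.indicator_of_mem hi]
  · rw [Set.indicator_of_notMem hi, Pi.smul_apply, Set.indicator_of_notMem hi, smul_zero]

/-- The charge `D_f = diagonal (f : ℂ)` acts on the fibre component `ψ|_{f = M}` as the real scalar `M`:
the fibre component lies in the `M`-eigenspace of the charge (the symmetry sector, Han 2020 §3).
[cite: Han2020Bootstrap, §3] -/
theorem diagonal_mulVec_indicator_fiber (f : n → ℝ) (M : ℝ) (ψ : n → ℂ) :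
    diagonal (fun i => ((f i : ℝ) : ℂ)) *ᵥ Set.indicator {i | f i = M} ψ =
      ((M : ℝ) : ℂ) • Set.indicator {i | f i = M} ψ := by
  ext i
  rw [mulVec_diagonal, Pi.smul_apply, smul_eq_mul]
  by_cases hi : f i = M
  · rw [Set.indicator_of_mem (show i ∈ {i | f i = M} from hi), hi]
  · rw [Set.indicator_of_notMem (show i ∉ {i | f i = M} from hi), mul_zero, mul_zero]

/-- **No matrix entries between different fibres**: an operator commuting with the charge,
`X D_f = D_f X`, has `X i j = 0` whenever `f i ≠ f j`. [folklore] -/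
private theorem entry_eq_zero_of_commute_realDiagonal {f : n → ℝ} {X : Matrix n n ℂ}
    (hX : X * diagonal (fun i => ((f i : ℝ) : ℂ)) = diagonal (fun i => ((f i : ℝ) : ℂ)) * X)
    {i j : n} (hij : f i ≠ f j) : X i j = 0 := by
  have h := congrFun (congrFun hX i) j
  rw [mul_diagonal, diagonal_mul] at h
  have h' : X i j * (((f j : ℝ) : ℂ) - ((f i : ℝ) : ℂ)) = 0 := by
    rw [mul_sub, h]
    ring
  rcases mul_eq_zero.mp h' with h0 | h0
  · exact h0
  · exfalso
    apply hij
    have h1 : ((f j : ℝ) : ℂ) = ((f i : ℝ) : ℂ) := sub_eq_zero.mp h0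
    exact_mod_cast h1.symm

/-- An operator commuting with the charge commutes with the restriction to every fibre:
`X (ψ|_{f = M}) = (X ψ)|_{f = M}`. In particular the fibre components of an eigenvector of a
charge-conserving `A` are eigenvectors of `A` with the same eigenvalue (symmetry sectors, Han 2020 §3).
[cite: Han2020Bootstrap, §3] -/
theorem mulVec_indicator_fiber_of_commute {f : n → ℝ} {X : Matrix n n ℂ}
    (hX : X * diagonal (fun i => ((f i : ℝ) : ℂ)) = diagonal (fun i => ((f i : ℝ) : ℂ)) * X)
    (M : ℝ) (ψ : n → ℂ) :
    X *ᵥ Set.indicator {i | f i = M} ψ = Set.indicator {i | f i = M} (X *ᵥ ψ) := by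
  ext i
  by_cases hi : f i = M
  · rw [Set.indicator_of_mem (show i ∈ {j | f j = M} from hi)]
    simp only [mulVec, dotProduct]
    refine Finset.sum_congr rfl fun j _ => ?_
    by_cases hj : f j = M
    · rw [Set.indicator_of_mem (show j ∈ {j | f j = M} from hj)]
    · rw [Set.indicator_of_notMem (show j ∉ {j | f j = M} from hj), mul_zero,
        entry_eq_zero_of_commute_realDiagonal hX (by rw [hi]; exact Ne.symm hj), zero_mul]
  · rw [Set.indicator_of_notMem (show i ∉ {j | f j = M} from hi)]
    simp only [mulVec, dotProduct]
    refine Finset.sum_eq_zero fun j _ => ?_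
    by_cases hj : f j = M
    · rw [entry_eq_zero_of_commute_realDiagonal hX (by rw [hj]; exact hi), zero_mul]
    · rw [Set.indicator_of_notMem (show j ∉ {j | f j = M} from hj), mul_zero]

/-- **The quadratic form of a charge-neutral operator splits over the fibres**:
`⟨ψ, X ψ⟩ = Σ_{M ∈ f(univ)} ⟨ψ|_{f = M}, X ψ|_{f = M}⟩` for `X D_f = D_f X` (block structure of
charge-neutral observables over the symmetry sectors, Han 2020 §3). [cite: Han2020Bootstrap, §3] -/
theorem star_dotProduct_mulVec_eq_sum_fiber {f : n → ℝ} {X : Matrix n n ℂ}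
    (hX : X * diagonal (fun i => ((f i : ℝ) : ℂ)) = diagonal (fun i => ((f i : ℝ) : ℂ)) * X)
    (ψ : n → ℂ) :
    star ψ ⬝ᵥ X *ᵥ ψ =
      ∑ M ∈ univ.image f, star (Set.indicator {i | f i = M} ψ) ⬝ᵥ X *ᵥ Set.indicator {i | f i = M} ψ := by
  have key : ∀ M : ℝ, star (Set.indicator {i | f i = M} ψ) ⬝ᵥ X *ᵥ Set.indicator {i | f i = M} ψ =
      ∑ i, if f i = M then star (ψ i) * (X *ᵥ ψ) i else 0 := by
    intro M
    rw [mulVec_indicator_fiber_of_commute hX, dotProduct]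
    refine Finset.sum_congr rfl fun i _ => ?_
    by_cases hi : f i = M
    · rw [if_pos hi, Pi.star_apply, Set.indicator_of_mem (show i ∈ {j | f j = M} from hi),
        Set.indicator_of_mem (show i ∈ {j | f j = M} from hi)]
    · rw [if_neg hi, Set.indicator_of_notMem (show i ∉ {j | f j = M} from hi), mul_zero]
  simp_rw [key]
  rw [Finset.sum_comm, dotProduct]
  refine Finset.sum_congr rfl fun i _ => ?_
  rw [Finset.sum_ite_eq (univ.image f) (f i) (fun _ => star (ψ i) * (X *ᵥ ψ) i),
    if_pos (mem_image_of_mem f (mem_univ i)), Pi.star_apply]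

/-- The norm splits over the fibres: `⟨ψ, ψ⟩ = Σ_{M ∈ f(univ)} ⟨ψ|_{f = M}, ψ|_{f = M}⟩`. [folklore] -/
private theorem star_dotProduct_self_eq_sum_fiber (f : n → ℝ) (ψ : n → ℂ) :
    star ψ ⬝ᵥ ψ =
      ∑ M ∈ univ.image f, star (Set.indicator {i | f i = M} ψ) ⬝ᵥ Set.indicator {i | f i = M} ψ := by
  have h1 : (1 : Matrix n n ℂ) * diagonal (fun i => ((f i : ℝ) : ℂ)) =
      diagonal (fun i => ((f i : ℝ) : ℂ)) * 1 := by rw [Matrix.one_mul, Matrix.mul_one]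
  have h := star_dotProduct_mulVec_eq_sum_fiber h1 ψ
  simp only [one_mulVec] at h
  exact h
end Fiber

/-! ## §2 Sector-wise eigenvector bounds hold for every eigenvector -/

section Vector
omit [DecidableEq n] in
/-- Homogenisation: a bound `c ≤ Re ⟨u, X u⟩` at a unit multiple `u = a • v` is the bound
`c · ⟨v, v⟩ ≤ Re ⟨v, X v⟩`. [folklore] -/
private theorem mul_re_le_re_of_unit_smul {v : n → ℂ} {a : ℂ} (h1 : star (a • v) ⬝ᵥ (a • v) = 1)
    {X : Matrix n n ℂ} {c : ℝ} (hb : c ≤ (star (a • v) ⬝ᵥ X *ᵥ (a • v)).re) :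
    c * (star v ⬝ᵥ v).re ≤ (star v ⬝ᵥ X *ᵥ v).re := by
  have hsv : star (a • v) ⬝ᵥ (a • v) = (star a * a) * (star v ⬝ᵥ v) := by
    rw [star_smul, smul_dotProduct, dotProduct_smul, smul_smul, smul_eq_mul]
  have hsX : star (a • v) ⬝ᵥ X *ᵥ (a • v) = (star a * a) * (star v ⬝ᵥ X *ᵥ v) := by
    rw [mulVec_smul, star_smul, smul_dotProduct, dotProduct_smul, smul_smul, smul_eq_mul]
  have hre : (star a * a).re = ‖a‖ ^ 2 := by
    rw [Complex.star_def, Complex.conj_mul', ← Complex.ofReal_pow, Complex.ofReal_re]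
  have him : (star a * a).im = 0 := by
    rw [Complex.star_def, Complex.conj_mul', ← Complex.ofReal_pow, Complex.ofReal_im]
  rw [hsX, Complex.mul_re, him, zero_mul, sub_zero, hre] at hb
  have h1' : ‖a‖ ^ 2 * (star v ⬝ᵥ v).re = 1 := by
    have h := congrArg Complex.re h1
    rwa [hsv, Complex.mul_re, him, zero_mul, sub_zero, hre, Complex.one_re] at h
  have hvv : 0 ≤ (star v ⬝ᵥ v).re := (Complex.nonneg_iff.mp (dotProduct_star_self_nonneg v)).1
  calc c * (star v ⬝ᵥ v).re ≤ (‖a‖ ^ 2 * (star v ⬝ᵥ X *ᵥ v).re) * (star v ⬝ᵥ v).re :=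
        mul_le_mul_of_nonneg_right hb hvv
    _ = (‖a‖ ^ 2 * (star v ⬝ᵥ v).re) * (star v ⬝ᵥ X *ᵥ v).re := by ring
    _ = (star v ⬝ᵥ X *ᵥ v).re := by rw [h1', one_mul]

/-- **Sector-wise bounds hold for every eigenvector.** `A` and `X` commute with the real diagonal
charge `D_f`; if `c ≤ Re ⟨φ, X φ⟩` for every unit `φ` in EVERY eigenspace of the charge
(`D_f φ = M φ`) with `A φ = E φ`, then `c ≤ Re ⟨ψ, X ψ⟩` for every unit `ψ` with `A ψ = E ψ` — no
charge hypothesis on `ψ` (its fibre components are such `φ` up to normalisation; sum over the fibres).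
Han 2020 §3 (symmetry sectors) read backwards. [cite: Han2020Bootstrap, §3] -/
theorem le_re_star_dotProduct_mulVec_of_forall_fiber {f : n → ℝ} {A X : Matrix n n ℂ}
    (hA : A * diagonal (fun i => ((f i : ℝ) : ℂ)) = diagonal (fun i => ((f i : ℝ) : ℂ)) * A)
    (hX : X * diagonal (fun i => ((f i : ℝ) : ℂ)) = diagonal (fun i => ((f i : ℝ) : ℂ)) * X)
    {E : ℂ} {c : ℝ}
    (h : ∀ (M : ℝ) (φ : n → ℂ), diagonal (fun i => ((f i : ℝ) : ℂ)) *ᵥ φ = ((M : ℝ) : ℂ) • φ →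
      star φ ⬝ᵥ φ = 1 → A *ᵥ φ = E • φ → c ≤ (star φ ⬝ᵥ X *ᵥ φ).re)
    {ψ : n → ℂ} (hψ1 : star ψ ⬝ᵥ ψ = 1) (hAψ : A *ᵥ ψ = E • ψ) :
    c ≤ (star ψ ⬝ᵥ X *ᵥ ψ).re := by
  -- the homogeneous bound on each fibre component
  have hfib : ∀ M : ℝ,
      c * (star (Set.indicator {i | f i = M} ψ) ⬝ᵥ Set.indicator {i | f i = M} ψ).re ≤
        (star (Set.indicator {i | f i = M} ψ) ⬝ᵥ X *ᵥ Set.indicator {i | f i = M} ψ).re := by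
    intro M
    set φ := Set.indicator {i | f i = M} ψ with hφ
    by_cases h0 : φ = 0
    · simp [h0]
    obtain ⟨a, -, h1⟩ := exists_smul_unit h0
    have hD : diagonal (fun i => ((f i : ℝ) : ℂ)) *ᵥ (a • φ) = ((M : ℝ) : ℂ) • (a • φ) := by
      rw [mulVec_smul, hφ, diagonal_mulVec_indicator_fiber, smul_comm]
    have hAφ : A *ᵥ (a • φ) = E • (a • φ) := by
      rw [mulVec_smul, hφ, mulVec_indicator_fiber_of_commute hA, hAψ, indicator_smul_vec, smul_comm]
    exact mul_re_le_re_of_unit_smul h1 (h M (a • φ) hD h1 hAφ)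
  -- sum over the fibres
  have hsum : c * ∑ M ∈ univ.image f,
      (star (Set.indicator {i | f i = M} ψ) ⬝ᵥ Set.indicator {i | f i = M} ψ).re ≤
      ∑ M ∈ univ.image f,
        (star (Set.indicator {i | f i = M} ψ) ⬝ᵥ X *ᵥ Set.indicator {i | f i = M} ψ).re := by
    rw [Finset.mul_sum]
    exact Finset.sum_le_sum fun M _ => hfib M
  have hn : ∑ M ∈ univ.image f,
      (star (Set.indicator {i | f i = M} ψ) ⬝ᵥ Set.indicator {i | f i = M} ψ).re = 1 := by
    rw [← Complex.re_sum, ← star_dotProduct_self_eq_sum_fiber f ψ, hψ1, Complex.one_re]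
  rw [hn, mul_one, ← Complex.re_sum, ← star_dotProduct_mulVec_eq_sum_fiber hX ψ] at hsum
  exact hsum

/-- Upper twin of `le_re_star_dotProduct_mulVec_of_forall_fiber`: sector-wise CEILINGS
`Re ⟨φ, X φ⟩ ≤ c` hold for every unit eigenvector `A ψ = E ψ`. [cite: Han2020Bootstrap, §3] -/
theorem re_star_dotProduct_mulVec_le_of_forall_fiber {f : n → ℝ} {A X : Matrix n n ℂ}
    (hA : A * diagonal (fun i => ((f i : ℝ) : ℂ)) = diagonal (fun i => ((f i : ℝ) : ℂ)) * A)
    (hX : X * diagonal (fun i => ((f i : ℝ) : ℂ)) = diagonal (fun i => ((f i : ℝ) : ℂ)) * X)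
    {E : ℂ} {c : ℝ}
    (h : ∀ (M : ℝ) (φ : n → ℂ), diagonal (fun i => ((f i : ℝ) : ℂ)) *ᵥ φ = ((M : ℝ) : ℂ) • φ →
      star φ ⬝ᵥ φ = 1 → A *ᵥ φ = E • φ → (star φ ⬝ᵥ X *ᵥ φ).re ≤ c)
    {ψ : n → ℂ} (hψ1 : star ψ ⬝ᵥ ψ = 1) (hAψ : A *ᵥ ψ = E • ψ) :
    (star ψ ⬝ᵥ X *ᵥ ψ).re ≤ c := by
  have hX' : (-X) * diagonal (fun i => ((f i : ℝ) : ℂ)) = diagonal (fun i => ((f i : ℝ) : ℂ)) * (-X) := by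
    rw [Matrix.neg_mul, Matrix.mul_neg, hX]
  have h' := le_re_star_dotProduct_mulVec_of_forall_fiber hA hX' (E := E) (c := -c)
    (fun M φ hD h1 hAφ => by
      rw [neg_mulVec, dotProduct_neg, Complex.neg_re]
      exact neg_le_neg (h M φ hD h1 hAφ)) hψ1 hAψ
  rw [neg_mulVec, dotProduct_neg, Complex.neg_re] at h'
  exact neg_le_neg_iff.mp h'
end Vector

/-! ## §3 Ground-state vectors and the tracial ground state -/

section Tracial
omit [DecidableEq n] in
/-- `⟨v, v⟩` is the real number `Re ⟨v, v⟩` (as a complex number). [folklore] -/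
private theorem star_dotProduct_self_eq_ofReal_re (v : n → ℂ) :
    star v ⬝ᵥ v = (((star v ⬝ᵥ v).re : ℝ) : ℂ) := by
  obtain ⟨-, him⟩ := Complex.nonneg_iff.mp (dotProduct_star_self_nonneg v)
  exact Complex.ext (by simp) (by simp [← him])

/-- **The trace behind the tracial ground state**: `tr(P₀ X) = Σ_σ ⟨P₀ e_σ, X P₀ e_σ⟩`
(`P₀ = groundProj A` is a Hermitian idempotent). Tasaki 2020 App. A.2. [cite: Tasaki2020, App. A.2] -/
theorem trace_groundProj_mul_eq_sum_col (A X : Matrix n n ℂ) :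
    (A.groundProj * X).trace = ∑ σ, star (A.groundProj.col σ) ⬝ᵥ X *ᵥ (A.groundProj.col σ) := by
  set P := A.groundProj with hPdef
  have hP : Pᴴ = P := (groundProj_isHermitian A).eq
  have hPP : P * P = P := groundProj_mul_self A
  have h1 : (P * X).trace = (Pᴴ * X * P).trace := by
    rw [hP]
    calc (P * X).trace = (X * P).trace := trace_mul_comm _ _
      _ = (X * (P * P)).trace := by rw [hPP]
      _ = (X * P * P).trace := by rw [Matrix.mul_assoc]
      _ = (P * (X * P)).trace := trace_mul_comm _ _
      _ = (P * X * P).trace := by rw [Matrix.mul_assoc]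
  rw [h1]
  simp only [Matrix.trace, Matrix.diag, Matrix.mul_apply, dotProduct, mulVec, Matrix.col_apply,
    Pi.star_apply, conjTranspose_apply, Finset.sum_mul, Finset.mul_sum]
  refine Finset.sum_congr rfl fun σ _ => ?_
  rw [Finset.sum_comm]
  refine Finset.sum_congr rfl fun a _ => Finset.sum_congr rfl fun b _ => ?_
  ring

/-- `tr P₀ = Σ_σ ⟨P₀ e_σ, P₀ e_σ⟩`. Tasaki 2020 App. A.2. [cite: Tasaki2020, App. A.2] -/
theorem trace_groundProj_eq_sum_col (A : Matrix n n ℂ) :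
    A.groundProj.trace = ∑ σ, star (A.groundProj.col σ) ⬝ᵥ (A.groundProj.col σ) := by
  have h := trace_groundProj_mul_eq_sum_col A 1
  rw [Matrix.mul_one] at h
  simpa only [one_mulVec] using h

/-- **The tracial ground state as a ratio of real column sums**:
`Re ω₀(X) = (Σ_σ Re ⟨P₀ e_σ, X P₀ e_σ⟩) / Σ_σ ⟨P₀ e_σ, P₀ e_σ⟩`. [cite: Tasaki2020, §2.1] -/
theorem re_groundStateFunctional_eq_div_sum_col (A X : Matrix n n ℂ) :
    (A.groundStateFunctional X).re =
      (∑ σ, (star (A.groundProj.col σ) ⬝ᵥ X *ᵥ A.groundProj.col σ).re) /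
        ∑ σ, (star (A.groundProj.col σ) ⬝ᵥ (A.groundProj.col σ)).re := by
  have hreal : (∑ σ, star (A.groundProj.col σ) ⬝ᵥ (A.groundProj.col σ)) =
      (((∑ σ, (star (A.groundProj.col σ) ⬝ᵥ (A.groundProj.col σ)).re) : ℝ) : ℂ) := by
    rw [Complex.ofReal_sum]
    exact Finset.sum_congr rfl fun σ _ => star_dotProduct_self_eq_ofReal_re _
  rw [groundStateFunctional_apply, trace_groundProj_mul_eq_sum_col A X, trace_groundProj_eq_sum_col A,
    hreal, ← Complex.ofReal_inv, Complex.re_ofReal_mul, Complex.re_sum, inv_mul_eq_div]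

/-- `tr P₀ > 0` as a real column sum, for Hermitian `A` on a nonempty index type.
[cite: Tasaki2020, §2.1] -/
theorem sum_re_col_groundProj_pos [Nonempty n] {A : Matrix n n ℂ} (hA : A.IsHermitian) :
    0 < ∑ σ, (star (A.groundProj.col σ) ⬝ᵥ (A.groundProj.col σ)).re := by
  have hnn : ∀ σ, 0 ≤ (star (A.groundProj.col σ) ⬝ᵥ (A.groundProj.col σ)).re := fun σ =>
    (Complex.nonneg_iff.mp (dotProduct_star_self_nonneg _)).1
  obtain ⟨σ₀, hσ₀⟩ : ∃ σ, A.groundProj.col σ ≠ 0 := by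
    by_contra hall
    push Not at hall
    have h0 : A.groundProj.trace = 0 := by
      rw [trace_groundProj_eq_sum_col]
      exact Finset.sum_eq_zero fun σ _ => by simp [hall σ]
    exact (trace_groundProj_ne_zero hA) h0
  have hpos₀ : 0 < (star (A.groundProj.col σ₀) ⬝ᵥ (A.groundProj.col σ₀)).re := by
    have hne : star (A.groundProj.col σ₀) ⬝ᵥ (A.groundProj.col σ₀) ≠ 0 := fun h0 =>
      hσ₀ (dotProduct_star_self_eq_zero.mp h0)
    rcases (hnn σ₀).lt_or_eq with hlt | heq
    · exact hlt
    · exfalso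
      apply hne
      rw [star_dotProduct_self_eq_ofReal_re (A.groundProj.col σ₀), ← heq]
      simp
  exact Finset.sum_pos' (fun σ _ => hnn σ) ⟨σ₀, Finset.mem_univ _, hpos₀⟩

/-- The columns of `P₀` are ground vectors: `A (P₀ e_σ) = E₀ (P₀ e_σ)`. Tasaki 2020 §2.1.
[cite: Tasaki2020, §2.1] -/
theorem groundProj_col_mem_groundSpace (A : Matrix n n ℂ) (σ : n) :
    A.groundProj.col σ ∈ A.groundSpace := by
  rw [← mulVec_single_one]
  exact groundProj_mulVec_mem A _

/-- **A bound in every ground-state vector is a bound in the tracial ground state.** For Hermitian `A`: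
if `c ≤ Re ⟨ψ, X ψ⟩` for every unit ground-state vector `ψ` (`Matrix.IsGroundStateVector`), then
`c ≤ Re ω₀(X)`, `ω₀ = Matrix.groundStateFunctional A` the uniform mixture of ground states
(Bratteli–Robinson II §5.3.1; columns of `P₀`, Tasaki 2020 App. A.2). [cite: BratteliRobinsonII1997, §5.3.1] -/
theorem le_re_groundStateFunctional_of_forall_isGroundStateVector [Nonempty n] {A : Matrix n n ℂ}
    (hA : A.IsHermitian) (X : Matrix n n ℂ) {c : ℝ}
    (h : ∀ ψ : n → ℂ, star ψ ⬝ᵥ ψ = 1 → A.IsGroundStateVector ψ → c ≤ (star ψ ⬝ᵥ X *ᵥ ψ).re) :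
    c ≤ (A.groundStateFunctional X).re := by
  have hcol : ∀ σ, c * (star (A.groundProj.col σ) ⬝ᵥ A.groundProj.col σ).re ≤
      (star (A.groundProj.col σ) ⬝ᵥ X *ᵥ (A.groundProj.col σ)).re := by
    intro σ
    set v := A.groundProj.col σ with hv
    have hvG : v ∈ A.groundSpace := groundProj_col_mem_groundSpace A σ
    by_cases h0 : v = 0
    · simp [h0]
    obtain ⟨a, ha, h1⟩ := exists_smul_unit h0
    have hgs : A.IsGroundStateVector (a • v) :=
      ⟨smul_ne_zero ha h0, by rw [mulVec_smul, (mem_groundSpace_iff A v).1 hvG, smul_comm]⟩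
    exact mul_re_le_re_of_unit_smul h1 (h (a • v) h1 hgs)
  have hsum : c * ∑ σ, (star (A.groundProj.col σ) ⬝ᵥ (A.groundProj.col σ)).re ≤
      ∑ σ, (star (A.groundProj.col σ) ⬝ᵥ X *ᵥ (A.groundProj.col σ)).re := by
    rw [Finset.mul_sum]
    exact Finset.sum_le_sum fun σ _ => hcol σ
  rw [re_groundStateFunctional_eq_div_sum_col, le_div_iff₀ (sum_re_col_groundProj_pos hA)]
  exact hsum

/-- Upper twin: `Re ⟨ψ, X ψ⟩ ≤ c` in every unit ground-state vector gives `Re ω₀(X) ≤ c`.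
[cite: BratteliRobinsonII1997, §5.3.1] -/
theorem re_groundStateFunctional_le_of_forall_isGroundStateVector [Nonempty n] {A : Matrix n n ℂ}
    (hA : A.IsHermitian) (X : Matrix n n ℂ) {c : ℝ}
    (h : ∀ ψ : n → ℂ, star ψ ⬝ᵥ ψ = 1 → A.IsGroundStateVector ψ → (star ψ ⬝ᵥ X *ᵥ ψ).re ≤ c) :
    (A.groundStateFunctional X).re ≤ c := by
  have h' := le_re_groundStateFunctional_of_forall_isGroundStateVector hA (-X) (c := -c)
    fun ψ h1 hgs => by
      rw [neg_mulVec, dotProduct_neg, Complex.neg_re]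
      exact neg_le_neg (h ψ h1 hgs)
  rw [map_neg, Complex.neg_re] at h'
  exact neg_le_neg_iff.mp h'
end Tracial

/-! ## §4 Sector-wise ground-state bounds and the tracial ground state -/

section SectorTracial
/-- **Sector-wise ground-state bounds are bounds in the tracial ground state.** `A` Hermitian and `X`
commuting with the real diagonal charge `D_f`; if `c ≤ Re ⟨φ, X φ⟩` for every unit ground-state vector
`φ` of `A` in EVERY eigenspace of the charge (`D_f φ = M φ`), then `c ≤ Re ω₀(X)` for the tracial
ground state `ω₀ = Matrix.groundStateFunctional A` (§2 at `E = E₀`, then §3). Han 2020 §3 with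
Bratteli–Robinson II §5.3.1. [cite: BratteliRobinsonII1997, §5.3.1] -/
theorem le_re_groundStateFunctional_of_forall_fiber [Nonempty n] {f : n → ℝ} {A X : Matrix n n ℂ}
    (hA : A.IsHermitian)
    (hAD : A * diagonal (fun i => ((f i : ℝ) : ℂ)) = diagonal (fun i => ((f i : ℝ) : ℂ)) * A)
    (hXD : X * diagonal (fun i => ((f i : ℝ) : ℂ)) = diagonal (fun i => ((f i : ℝ) : ℂ)) * X)
    {c : ℝ}
    (h : ∀ (M : ℝ) (φ : n → ℂ), diagonal (fun i => ((f i : ℝ) : ℂ)) *ᵥ φ = ((M : ℝ) : ℂ) • φ →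
      star φ ⬝ᵥ φ = 1 → A.IsGroundStateVector φ → c ≤ (star φ ⬝ᵥ X *ᵥ φ).re) :
    c ≤ (A.groundStateFunctional X).re := by
  refine le_re_groundStateFunctional_of_forall_isGroundStateVector hA X fun ψ hψ1 hgs => ?_
  refine le_re_star_dotProduct_mulVec_of_forall_fiber hAD hXD (E := (A.groundEnergy : ℂ))
    (fun M φ hD h1 hAφ => h M φ hD h1 ⟨?_, hAφ⟩) hψ1 hgs.2
  intro h0
  rw [h0, dotProduct_zero] at h1
  exact zero_ne_one h1

/-- Upper twin of `le_re_groundStateFunctional_of_forall_fiber`: sector-wise ground-state CEILINGS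
`Re ⟨φ, X φ⟩ ≤ c` give `Re ω₀(X) ≤ c`. [cite: BratteliRobinsonII1997, §5.3.1] -/
theorem re_groundStateFunctional_le_of_forall_fiber [Nonempty n] {f : n → ℝ} {A X : Matrix n n ℂ}
    (hA : A.IsHermitian)
    (hAD : A * diagonal (fun i => ((f i : ℝ) : ℂ)) = diagonal (fun i => ((f i : ℝ) : ℂ)) * A)
    (hXD : X * diagonal (fun i => ((f i : ℝ) : ℂ)) = diagonal (fun i => ((f i : ℝ) : ℂ)) * X)
    {c : ℝ}
    (h : ∀ (M : ℝ) (φ : n → ℂ), diagonal (fun i => ((f i : ℝ) : ℂ)) *ᵥ φ = ((M : ℝ) : ℂ) • φ →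
      star φ ⬝ᵥ φ = 1 → A.IsGroundStateVector φ → (star φ ⬝ᵥ X *ᵥ φ).re ≤ c) :
    (A.groundStateFunctional X).re ≤ c := by
  refine re_groundStateFunctional_le_of_forall_isGroundStateVector hA X fun ψ hψ1 hgs => ?_
  refine re_star_dotProduct_mulVec_le_of_forall_fiber hAD hXD (E := (A.groundEnergy : ℂ))
    (fun M φ hD h1 hAφ => h M φ hD h1 ⟨?_, hAφ⟩) hψ1 hgs.2
  intro h0
  rw [h0, dotProduct_zero] at h1
  exact zero_ne_one h1
end SectorTracial

end Literature.MathematicalPhysics.QuantumLattice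

end
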